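import Summits.BirchSwinnertonDyer.BirchSwinnertonDyer.Theorems.QuadraticBranchSignedControlPlusEtaLowerInclusionFouquetWanLocus
import Literature.NumberTheory.EllipticCurves.FouquetWan2021.EtaKatoMainConjectureOPEN
import HarnessLib

/-!
# Route `QuadraticBranchSignedControl` (rung K8, cell `bsd-potss`), child crux `PlusEtaLowerInclusion`
# (item stmt-BirchSwinnertonDyer-19601), registered stub `stub_etaLower_fwLocus`: the stub from the
# NAMED PRE binder `FouquetWan2021.thm51_etaKatoMC_OPEN` ALONE (by-name instantiation)

WHAT. `Theorems/QuadraticBranchSignedControlPlusEtaLowerInclusionFouquetWanLocus.lean` (this seat, g0)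
derives (C1⁺_η), (E⁺_η), the registered stub `Sig.stub_etaLower_fwLocus` (VERBATIM) and the crux-modulo-
off-locus composition from a DISPLAYED ∀-frame `hFW` — Kato's main conjecture for `T_pV` at the
component `η = ω^{(p−1)/2}` in the currency of Kobayashi's proof of Thm. 7.4, on the Fouquet–Wan locus
of the additive partner `W = V ⊗ η`. That frame is now the NAMED Literature binder
`FouquetWan2021.thm51_etaKatoMC_OPEN` (`Literature/…/FouquetWan2021/EtaKatoMainConjectureOPEN.lean`:
Fouquet–Wan arXiv:2107.13726 Thm. 5.1 / Prop. 5.6 for `f_W` — an UNREFEREED CLAIM, `[claim: …,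
status: under-review]`, reading flag `FW21-eta-twist-transfer`); this file instantiates, so that the
stub is CONDITIONAL ON EXACTLY ONE NAMED PRE BINDER (the programme's ACCEL row (6): «if found ⇒
`stub_etaLower_fwLocus` conditional on one PRE cite-level fact; 19601 closes with (offLocus) only»):
* `stub_etaLower_fwLocus_of_thm51_etaKatoMC_OPEN` — `Sig.stub_etaLower_fwLocus` VERBATIM from the binder;
* `plusEtaMainConjectureAt_of_thm51_etaKatoMC_OPEN` / `plusEtaLowerInclusionAt_…` — (C1⁺_η) / (E⁺_η)
  per pair on the locus from the binder;
* `plusEtaLowerInclusion_of_thm51_etaKatoMC_OPEN_of_offLocus` — the crux BY NAME from the binder and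
  `Sig.stub_etaLower_offLocus` alone.

HONEST FRAMING (cell `bsd-potss`, run/shared/lean/pub/bsd-potss/; FULL-BSD rank ≤ 1 programme):
TOOL THEOREMS ONLY — no definition, no named fact minted here, no `sorry`, axioms standard.
CONDITIONAL (`conditional-result`) on the PRE binder `thm51_etaKatoMC_OPEN` (never a theorem of
record; refereed status: none); nothing is asserted about any curve unconditionally; the crux 19601 is
NOT closed; nothing is booked; `BSD(W, p)` is claimed for no pair; BSD is not proved by any of this.
Seat `bsd-potss-k8-fw` (prover), g0; `--supports stmt-BirchSwinnertonDyer-19601 --as helper`.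

References: [FouquetWan2021] Thm. 5.1 (p. 53), Prop. 5.6 (p. 54) (claim; hypothesis only);
[Kobayashi2003] §4 (p. 8), §5 (p. 10), Thm. 7.4 (p. 13).
-/

set_option autoImplicit false
-- single-problem summit: the namespace `Summit.BirchSwinnertonDyer.BirchSwinnertonDyer.Theorems` repeats a
-- component by design (D-0017 layout), which `linter.dupNamespace` would flag on every declaration
set_option linter.dupNamespace false

noncomputable section

open scoped Classical

open WeierstrassCurve
open Literature.NumberTheory.EllipticCurves
open Literature.NumberTheory.EllipticCurves.Rank1Residual
open Summit.BirchSwinnertonDyer.Rank1Residual.Additive hiding EtaSignedSelmerDualData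
  IsQuadraticBranchPlusLFunction IsQuadraticBranchMinusLFunction
open Summit.BirchSwinnertonDyer.BirchSwinnertonDyer.Theses.QuadraticBranchSignedControl

namespace Summit.BirchSwinnertonDyer.BirchSwinnertonDyer.Theorems

/-- **(C1⁺_η) per pair on the Fouquet–Wan locus of the additive partner, from the NAMED PRE binder**
`FouquetWan2021.thm51_etaKatoMC_OPEN` (Fouquet–Wan Thm. 5.1 / Prop. 5.6 for `f_W`, an unrefereed CLAIM,
read at the `η`-component; hypothesis only): `plusEtaMainConjectureAt_of_etaKatoClaimFrame`
instantiated. CONDITIONAL; closes nothing.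
[cite: FouquetWan2021, Thm. 5.1 (p. 53) and Prop. 5.6 (p. 54) (claim; hypothesis only)]
[cite: Kobayashi2003, §5 (p. 10), Thm. 7.4 (p. 13), §4 (p. 8)] -/
theorem plusEtaMainConjectureAt_of_thm51_etaKatoMC_OPEN (hFW : FouquetWan2021.thm51_etaKatoMC_OPEN)
    (W : WeierstrassCurve ℚ) [W.IsElliptic] [W.IsGloballyMinimal]
    (V : WeierstrassCurve ℚ) [V.IsElliptic] [V.IsGloballyMinimal] (C : VariableChange ℚ)
    (p : ℕ) [Fact p.Prime] (hp2 : p ≠ 2) (hWV : C • W.quadraticTwist ((-1) ^ (p / 2) * p) = V)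
    (hgood : V.HasGoodReductionAtPrime p) (hap : V.frobeniusTrace p = 0) (hirr : Irr W p)
    (hR : ∃ (ℓ : ℕ) (_ : Fact ℓ.Prime), ℓ ≠ p ∧ W.HasMultiplicativeReductionAtPrime ℓ ∧
      ¬ W.HasSplitMultiplicativeReductionAtPrime ℓ ∧ ¬ p ∣ padicValInt ℓ W.minimalDiscriminantInt) :
    QuadraticBranchPlusEtaMainConjectureAt V p :=
  plusEtaMainConjectureAt_of_etaKatoClaimFrame hFW W V C p hp2 hWV hgood hap hirr hR

/-- **(E⁺_η) per pair on the Fouquet–Wan locus, from the NAMED PRE binder** (lower half of the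
previous theorem). CONDITIONAL; closes nothing.
[cite: FouquetWan2021, Thm. 5.1 (p. 53) (claim; hypothesis only)] [cite: Kobayashi2003, §4 (p. 8)] -/
theorem plusEtaLowerInclusionAt_of_thm51_etaKatoMC_OPEN (hFW : FouquetWan2021.thm51_etaKatoMC_OPEN)
    (W : WeierstrassCurve ℚ) [W.IsElliptic] [W.IsGloballyMinimal]
    (V : WeierstrassCurve ℚ) [V.IsElliptic] [V.IsGloballyMinimal] (C : VariableChange ℚ)
    (p : ℕ) [Fact p.Prime] (hp2 : p ≠ 2) (hWV : C • W.quadraticTwist ((-1) ^ (p / 2) * p) = V)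
    (hgood : V.HasGoodReductionAtPrime p) (hap : V.frobeniusTrace p = 0) (hirr : Irr W p)
    (hR : ∃ (ℓ : ℕ) (_ : Fact ℓ.Prime), ℓ ≠ p ∧ W.HasMultiplicativeReductionAtPrime ℓ ∧
      ¬ W.HasSplitMultiplicativeReductionAtPrime ℓ ∧ ¬ p ∣ padicValInt ℓ W.minimalDiscriminantInt) :
    QuadraticBranchPlusEtaLowerInclusionAt V p :=
  plusEtaLowerInclusionAt_of_etaKatoClaimFrame hFW W V C p hp2 hWV hgood hap hirr hR

/-- **`Sig.stub_etaLower_fwLocus` (registered stub of crux 19601, VERBATIM, `FWLocus V p` unfolded)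
from the NAMED PRE binder `FouquetWan2021.thm51_etaKatoMC_OPEN` ALONE** — the stub is conditional on
exactly one named unpublished input (Fouquet–Wan Thm. 5.1 / Prop. 5.6 for `f_W` read at the
`η`-component; PRE; flag `FW21-eta-twist-transfer`), everything else kernel-checked or proved in the
tree (`stub_etaLower_fwLocus_of_etaKatoClaimFrame`). CONDITIONAL; closes nothing (19601 needs the
off-locus stub; the sub-locus rows are CLAIMED, not refereed).
[cite: FouquetWan2021, Thm. 5.1 (p. 53) and Prop. 5.6 (p. 54) (claim; hypothesis only)]
[cite: Kobayashi2003, §4 (p. 8), §5 (p. 10), Thm. 7.4 (p. 13)] [cite: Serre1972, §1.11 Prop. 12] -/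
theorem stub_etaLower_fwLocus_of_thm51_etaKatoMC_OPEN (hFW : FouquetWan2021.thm51_etaKatoMC_OPEN) :
    ∀ (V : WeierstrassCurve ℚ) [V.IsElliptic] [V.IsGloballyMinimal] (p : ℕ) [Fact p.Prime],
      5 ≤ p → V.HasGoodReductionAtPrime p → V.frobeniusTrace p = 0 →
      (∀ m : ℕ, V.HasSurjectiveModNGaloisRep (p ^ m : ℕ)) →
      (∃ (W : WeierstrassCurve ℚ) (_ : W.IsElliptic) (_ : W.IsGloballyMinimal) (C : VariableChange ℚ),
        C • W.quadraticTwist ((-1) ^ (p / 2) * p) = V ∧ Addv W p ∧ SubGss W p ∧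
          FWNonsplitRam W p ∧ Kato2004.ImageContainsSL2 W p) →
      QuadraticBranchPlusEtaLowerInclusionAt V p :=
  stub_etaLower_fwLocus_of_etaKatoClaimFrame hFW

/-- **The crux `PlusEtaLowerInclusion` (item 19601) BY NAME from the NAMED PRE binder and the off-locus
stub `Sig.stub_etaLower_offLocus` (VERBATIM, displayed) ALONE**: modulo the Fouquet–Wan claim-binder
the item IS its off-locus stub. CONDITIONAL; closes nothing; the item owner assembles.
[cite: FouquetWan2021, Thm. 5.1 (p. 53) (claim; hypothesis only)] [cite: Kobayashi2003, §4 (p. 8)] -/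
theorem plusEtaLowerInclusion_of_thm51_etaKatoMC_OPEN_of_offLocus
    (hFW : FouquetWan2021.thm51_etaKatoMC_OPEN)
    (hoff : ∀ (V : WeierstrassCurve ℚ) [V.IsElliptic] [V.IsGloballyMinimal] (p : ℕ) [Fact p.Prime],
      5 ≤ p → V.HasGoodReductionAtPrime p → V.frobeniusTrace p = 0 →
      (∀ m : ℕ, V.HasSurjectiveModNGaloisRep (p ^ m : ℕ)) →
      ¬ (∃ (W : WeierstrassCurve ℚ) (_ : W.IsElliptic) (_ : W.IsGloballyMinimal) (C : VariableChange ℚ),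
        C • W.quadraticTwist ((-1) ^ (p / 2) * p) = V ∧ Addv W p ∧ SubGss W p ∧
          FWNonsplitRam W p ∧ Kato2004.ImageContainsSL2 W p) →
      QuadraticBranchPlusEtaLowerInclusionAt V p) :
    PlusEtaLowerInclusion :=
  plusEtaLowerInclusion_of_etaKatoClaimFrame_of_offLocus hFW hoff

end Summit.BirchSwinnertonDyer.BirchSwinnertonDyer.Theorems

end
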